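import Mathlib
import HarnessLib
import Literature.MathematicalPhysics.KineticTheory.HardSphereEulerProofs
import Summits.AtomisticToContinuum.HydrodynamicLimit.Theses.OneFlightGossipEngine
import Summits.AtomisticToContinuum.HydrodynamicLimit.Theorems.OneFlightGossipEngineKineticCurrentsWindowLDUniformEntropyQuasiInvariance

/-!
# Window transfer from Rényi quasi-invariance along a profile family — stub
# `stub_windowTransferFamily_of_renyi` of line `Sketch`, crux `KineticCurrentsLDAlongFamilies`
# (stmt-AtomisticToContinuum-16659)

Route `OneFlightGossipEngine`, sub-problem `HydrodynamicLimit`, stub S3 of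
`Cruxes/KineticCurrentsLDAlongFamilies/Lines/Sketch.lean`: the SINGLE-TIME WINDOW TRANSFER along a
jointly continuous positive profile family `s ∈ [0, t₁]` (expectations of non-negative measurable
functionals at any time `r` of the kinetic window `[0, τ(N+1)^{-1/3}]` under the local Gibbs law
`λ_s = ψ_s dL` are bounded by `e^{δ(N+1)}` times the `L^q(λ_s)`-norm at time `0`, thresholds
uniform in `s`) follows from the RÉNYI QUASI-INVARIANCE of order `p > 1` along the family
(stub S2, taken here as the antecedent), `∫ (ψ_s∘Φ_{-r})^p ψ_s^{1-p} dL ≤ e^{pδ(N+1)}`, with the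
conjugate exponent `q = p/(p-1)`.

This is the family re-typing of the landed glue
`KineticCurrentsWindowLDUniformSketch.stub_windowTransfer_of_renyi` (crux 14662): at fixed
profiles, `N`, `r` (`WindowTransfer.wtf_lintegral_comp_flow_le_of_renyi`, adapted from the private
workhorse of that file) one writes `λ = ψ dL`, transports the density along the
Liouville-preserving flow (`∫ ψ · G∘Φ_r dL = ∫ (ψ∘Φ_{-r}) · G dL`, a.e. inversion
`Φ_{-r} ∘ Φ_r = id` on the conull good set, where `ψ > 0`), and applies Hölder in `ℝ≥0∞` to
`(G ψ^{1/q}) · ((ψ∘Φ_{-r}) ψ^{-1/q})`; finally `(e^{pδ(N+1)})^{1/p} = e^{δ(N+1)}`. The family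
version applies this at the slice `(a s, u₀ s, θ₀ s)` (continuous and positive) with the threshold
`N₀` of the antecedent, which is already uniform in `s ∈ [0, t₁]`.
-/

noncomputable section

open MeasureTheory Set Filter
open scoped ENNReal Topology

namespace Summit.AtomisticToContinuum.HydrodynamicLimit.Theorems.KineticCurrentsLDAlongFamiliesSketch

open Literature.Analysis.FluidPDE (HardSphereFlow Config localMaxwellian canonicalDensity liouville)
open Literature.MathematicalPhysics.KineticTheory (T3 V3 hsDiameter localGibbsLaw localGibbsMeasure
  localGibbsProfile)
open Literature.Analysis.FluidPDE Literature.MathematicalPhysics.KineticTheory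

namespace WindowTransfer

/-- **Hölder glue at fixed profiles, `N`, `r`.** For continuous profiles `a, θ₀ > 0`, `u₀`,
`σ ≤ 1/2` (so the canonical local Gibbs density `ψ` is positive on the hard-sphere domain), a
hard-sphere flow `Φ`, conjugate exponents `p⁻¹ + q⁻¹ = 1` and a measurable `G ≥ 0`: if the Rényi
integral `∫ (ψ∘Φ_{-r})^p ψ^{1-p} dL ≤ B` (`L` the Liouville measure), then
`∫ G∘Φ_r dλ ≤ B^{1/p} (∫ G^q dλ)^{1/q}` for the local Gibbs law `λ = ψ dL` — Liouville transport
of the density, a.e. inversion on the good set, Hölder in `ℝ≥0∞`. [folklore] -/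
theorem wtf_lintegral_comp_flow_le_of_renyi {σ : ℝ} {a θ₀ : T3 → ℝ} {u₀ : T3 → V3}
    (ha : Continuous a) (hθ : Continuous θ₀) (hu : Continuous u₀)
    (ha0 : ∀ x, 0 < a x) (hθ0 : ∀ x, 0 < θ₀ x) (hσ2 : σ ≤ 1 / 2) {N : ℕ}
    (Φ : HardSphereFlow (Literature.Analysis.FluidPDE.Torus.geometry (Fin 3)) (hsDiameter σ N)
      (N + 1))
    {p q : ℝ} (hpq : p.HolderConjugate q) (r : ℝ) (B : ℝ≥0∞)
    (hR : ∫⁻ z, ENNReal.ofReal (canonicalDensity (Literature.Analysis.FluidPDE.Torus.geometry (Fin 3))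
              (hsDiameter σ N) (N + 1) (localGibbsProfile a u₀ θ₀) (Φ.flow (-r) z)) ^ p *
            ENNReal.ofReal (canonicalDensity (Literature.Analysis.FluidPDE.Torus.geometry (Fin 3))
              (hsDiameter σ N) (N + 1) (localGibbsProfile a u₀ θ₀) z) ^ (1 - p)
          ∂(liouville (Literature.Analysis.FluidPDE.Torus.geometry (Fin 3)) (N + 1)
            (hsDiameter σ N)) ≤ B)
    (G : Config (N + 1) (Fin 3) T3 → ℝ≥0∞) (hG : Measurable G) :
    ∫⁻ z, G (Φ.flow r z) ∂(localGibbsLaw σ a u₀ θ₀ N Φ) ≤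
      B ^ (1 / p) * (∫⁻ z, G z ^ q ∂(localGibbsLaw σ a u₀ θ₀ N Φ)) ^ (1 / q) := by
  -- adapted from `KineticCurrentsWindowLDUniformSketch.transfer_of_renyi_fixed` (private in
  -- Theorems/OneFlightGossipEngineKineticCurrentsWindowLDUniformWindowTransferOfRenyi.lean, p89950)
  set L := liouville (Literature.Analysis.FluidPDE.Torus.geometry (Fin 3)) (N + 1) (hsDiameter σ N)
    with hL
  set ψ : Config (N + 1) (Fin 3) T3 → ℝ≥0∞ := fun z => ENNReal.ofReal
    (canonicalDensity (Literature.Analysis.FluidPDE.Torus.geometry (Fin 3)) (hsDiameter σ N) (N + 1)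
      (localGibbsProfile a u₀ θ₀) z) with hψ
  have hlaw : localGibbsLaw σ a u₀ θ₀ N Φ = L.withDensity ψ := rfl
  have hψm : Measurable ψ :=
    (measurable_canonicalDensity (hsDiameter σ N) (N + 1)
      (measurable_localGibbsProfile ha hθ hu)).ennreal_ofReal
  have hψ0 : ∀ z ∈ Φ.good, ψ z ≠ 0 := fun z hz =>
    (ENNReal.ofReal_pos.2
      (KineticCurrentsWindowLDUniformLocalGibbs.eqi_canonicalDensity_pos_of_mem ha hθ hu ha0 hθ0
        hσ2 (Φ.good_subset hz))).ne'
  have hψt : ∀ z, ψ z ≠ ⊤ := fun z => ENNReal.ofReal_ne_top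
  -- Step 1: densities.
  have hGr : Measurable fun z => G (Φ.flow r z) := hG.comp (Φ.measurable_flow r)
  have hGq : Measurable fun z => G z ^ q := hG.pow_const q
  rw [hlaw, lintegral_withDensity_eq_lintegral_mul _ hψm hGr,
    lintegral_withDensity_eq_lintegral_mul _ hψm hGq]
  -- Step 2: Liouville transport `∫ ψ · G ∘ Φ_r dL = ∫ (ψ ∘ Φ_{-r}) · G dL`.
  have h2 : ∫⁻ z, (ψ * fun w => G (Φ.flow r w)) z ∂L = ∫⁻ z, ψ (Φ.flow (-r) z) * G z ∂L := by
    have hae : (fun z => (ψ * fun w => G (Φ.flow r w)) z) =ᵐ[L]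
        fun z => (fun w => ψ (Φ.flow (-r) w) * G w) (Φ.flow r z) := by
      filter_upwards [Φ.ae_mem_good] with z hz
      simp only [Pi.mul_apply, Φ.flow_neg_flow r hz]
    rw [lintegral_congr_ae hae]
    exact (Φ.measurePreserving r).lintegral_comp ((hψm.comp (Φ.measurable_flow (-r))).mul hG)
  rw [h2]
  -- Step 3: Hölder with `f = G ψ^{1/q}`, `g = (ψ ∘ Φ_{-r}) ψ^{-1/q}`.
  set f : Config (N + 1) (Fin 3) T3 → ℝ≥0∞ := fun z => G z * ψ z ^ (1 / q) with hf
  set g : Config (N + 1) (Fin 3) T3 → ℝ≥0∞ := fun z => ψ (Φ.flow (-r) z) * (ψ z)⁻¹ ^ (1 / q)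
    with hg
  have hfm : Measurable f := hG.mul (hψm.pow_const _)
  have hgm : Measurable g := (hψm.comp (Φ.measurable_flow (-r))).mul (hψm.inv.pow_const _)
  have h3 : ∫⁻ z, ψ (Φ.flow (-r) z) * G z ∂L = ∫⁻ z, (f * g) z ∂L := by
    refine lintegral_congr_ae ?_
    filter_upwards [Φ.ae_mem_good] with z hz
    simp only [hf, hg, Pi.mul_apply]
    calc ψ (Φ.flow (-r) z) * G z
        = ψ (Φ.flow (-r) z) * G z * (ψ z * (ψ z)⁻¹) ^ (1 / q) := by
          rw [ENNReal.mul_inv_cancel (hψ0 z hz) (hψt z), ENNReal.one_rpow, mul_one]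
      _ = G z * ψ z ^ (1 / q) * (ψ (Φ.flow (-r) z) * (ψ z)⁻¹ ^ (1 / q)) := by
          rw [ENNReal.mul_rpow_of_nonneg _ _ hpq.symm.one_div_nonneg]; ring
  rw [h3]
  refine (ENNReal.lintegral_mul_le_Lp_mul_Lq L hpq.symm hfm.aemeasurable hgm.aemeasurable).trans ?_
  -- Step 4: identify `∫ f^q = ∫ ψ G^q` and `∫ g^p = Rényi integral ≤ B`.
  have hq0 : q ≠ 0 := hpq.symm.ne_zero
  have h4f : ∫⁻ z, f z ^ q ∂L = ∫⁻ z, (ψ * fun w => G w ^ q) z ∂L := by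
    refine lintegral_congr fun z => ?_
    simp only [hf, Pi.mul_apply]
    rw [ENNReal.mul_rpow_of_nonneg _ _ hpq.symm.nonneg, ← ENNReal.rpow_mul,
      one_div_mul_cancel hq0, ENNReal.rpow_one, mul_comm]
  have h4g : ∫⁻ z, g z ^ p ∂L = ∫⁻ z, ψ (Φ.flow (-r) z) ^ p * ψ z ^ (1 - p) ∂L := by
    refine lintegral_congr fun z => ?_
    simp only [hg]
    rw [ENNReal.mul_rpow_of_nonneg _ _ hpq.nonneg, ← ENNReal.rpow_mul, ENNReal.inv_rpow,
      ← ENNReal.rpow_neg]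
    congr 2
    rw [one_div_mul_eq_div, hpq.div_conj_eq_sub_one]
    ring
  rw [h4f, h4g, mul_comm]
  exact mul_le_mul_left (ENNReal.rpow_le_rpow hR hpq.one_div_nonneg) _

end WindowTransfer

/-- **S3 — single-time window transfer along the family from Rényi quasi-invariance** (stub
`stub_windowTransferFamily_of_renyi` of line `Sketch`, crux `KineticCurrentsLDAlongFamilies`,
stmt-AtomisticToContinuum-16659). If along a jointly continuous positive profile family on
`[0, t₁] × 𝕋³` (`0 < σ ≤ 1/2`) the local Gibbs laws `λ_s = ψ_s dL` are Rényi quasi-invariant of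
some order `p > 1` over the kinetic window, `∫ (ψ_s∘Φ_{-r})^p ψ_s^{1-p} dL ≤ e^{pδ(N+1)}` for
`N ≥ N₀(τ, δ, Φ)` uniformly in `s ∈ [0, t₁]`, `r ∈ [0, τ(N+1)^{-1/3}]`, then with `q = p/(p-1)`:
`∫ g∘Φ_r dλ_s ≤ e^{δ(N+1)} (∫ g^q dλ_s)^{1/q}` for every measurable `g ≥ 0`, same thresholds
(Liouville transport of the density, a.e. inversion on the good set, Hölder in `ℝ≥0∞`).
[folklore] -/
theorem stub_windowTransferFamily_of_renyi :
    (∀ (t₁ : ℝ) (a θ₀ : ℝ → T3 → ℝ) (u₀ : ℝ → T3 → V3),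
      Continuous (Function.uncurry a) → Continuous (Function.uncurry θ₀) →
      Continuous (Function.uncurry u₀) → (∀ s x, 0 < a s x) → (∀ s x, 0 < θ₀ s x) →
      ∀ σ : ℝ, 0 < σ → σ ≤ 1 / 2 →
      ∃ p : ℝ, 1 < p ∧ ∀ τ : ℝ, 0 < τ → ∀ δ : ℝ, 0 < δ →
      ∀ Φ : (N : ℕ) →
        HardSphereFlow (Literature.Analysis.FluidPDE.Torus.geometry (Fin 3)) (hsDiameter σ N) (N + 1),
      ∃ N₀ : ℕ, ∀ N : ℕ, N₀ ≤ N → ∀ s ∈ Icc 0 t₁,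
      ∀ r ∈ Icc (0 : ℝ) (τ * ((N : ℝ) + 1) ^ (-(1 / 3 : ℝ))),
        ∫⁻ z, ENNReal.ofReal (canonicalDensity (Literature.Analysis.FluidPDE.Torus.geometry (Fin 3))
              (hsDiameter σ N) (N + 1) (localGibbsProfile (a s) (u₀ s) (θ₀ s)) ((Φ N).flow (-r) z)) ^ p *
            ENNReal.ofReal (canonicalDensity (Literature.Analysis.FluidPDE.Torus.geometry (Fin 3))
              (hsDiameter σ N) (N + 1) (localGibbsProfile (a s) (u₀ s) (θ₀ s)) z) ^ (1 - p)
          ∂(liouville (Literature.Analysis.FluidPDE.Torus.geometry (Fin 3)) (N + 1) (hsDiameter σ N)) ≤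
        ENNReal.ofReal (Real.exp (p * (δ * ((N : ℝ) + 1))))) →
    ∀ (t₁ : ℝ) (a θ₀ : ℝ → T3 → ℝ) (u₀ : ℝ → T3 → V3),
    Continuous (Function.uncurry a) → Continuous (Function.uncurry θ₀) →
    Continuous (Function.uncurry u₀) → (∀ s x, 0 < a s x) → (∀ s x, 0 < θ₀ s x) →
    ∀ σ : ℝ, 0 < σ → σ ≤ 1 / 2 →
    ∃ q : ℝ, 1 ≤ q ∧ ∀ τ : ℝ, 0 < τ → ∀ δ : ℝ, 0 < δ →
    ∀ Φ : (N : ℕ) →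
      HardSphereFlow (Literature.Analysis.FluidPDE.Torus.geometry (Fin 3)) (hsDiameter σ N) (N + 1),
    ∃ N₀ : ℕ, ∀ N : ℕ, N₀ ≤ N → ∀ s ∈ Icc 0 t₁,
    ∀ r ∈ Icc (0 : ℝ) (τ * ((N : ℝ) + 1) ^ (-(1 / 3 : ℝ))),
    ∀ g : Config (N + 1) (Fin 3) T3 → ℝ≥0∞, Measurable g →
      ∫⁻ z, g ((Φ N).flow r z) ∂(localGibbsLaw σ (a s) (u₀ s) (θ₀ s) N (Φ N)) ≤
        ENNReal.ofReal (Real.exp (δ * ((N : ℝ) + 1))) *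
          (∫⁻ z, g z ^ q ∂(localGibbsLaw σ (a s) (u₀ s) (θ₀ s) N (Φ N))) ^ (1 / q) := by
  intro hRenyi t₁ a θ₀ u₀ ha hθ hu ha0 hθ0 σ hσ hσ2
  obtain ⟨p, hp1, hp⟩ := hRenyi t₁ a θ₀ u₀ ha hθ hu ha0 hθ0 σ hσ hσ2
  have hpq : p.HolderConjugate (Real.conjExponent p) := Real.HolderConjugate.conjExponent hp1
  refine ⟨Real.conjExponent p, hpq.symm.lt.le, ?_⟩
  intro τ hτ δ hδ Φ
  obtain ⟨N₀, hN₀⟩ := hp τ hτ δ hδ Φ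
  refine ⟨N₀, fun N hN s hs r hr g hg => ?_⟩
  have h := WindowTransfer.wtf_lintegral_comp_flow_le_of_renyi (ha.uncurry_left s)
    (hθ.uncurry_left s) (hu.uncurry_left s) (ha0 s) (hθ0 s) hσ2 (Φ N) hpq r _
    (hN₀ N hN s hs r hr) g hg
  -- `(e^{pδ(N+1)})^{1/p} = e^{δ(N+1)}`
  have hexp : ENNReal.ofReal (Real.exp (p * (δ * ((N : ℝ) + 1)))) ^ (1 / p) =
      ENNReal.ofReal (Real.exp (δ * ((N : ℝ) + 1))) := by
    rw [ENNReal.ofReal_rpow_of_nonneg (Real.exp_pos _).le (one_div_pos.2 hpq.pos).le,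
      ← Real.exp_mul, mul_comm p (δ * ((N : ℝ) + 1)), mul_assoc, mul_one_div_cancel hpq.pos.ne',
      mul_one]
  rwa [hexp] at h

end Summit.AtomisticToContinuum.HydrodynamicLimit.Theorems.KineticCurrentsLDAlongFamiliesSketch

end
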